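import Summits.AtomisticToContinuum.Crystallization.Theorems.PeriodCoherenceLadderCleanRegions

/-!
# Route `PeriodCoherenceLadder`, residual crux `MesoscopicCoarsePeriods`: SPARSE BAD BALLS LEAVE CLEAN WINDOWS

Second (geometric) step of the line beneath the residual crux.  A ball `B(c, 4b+1)` of a point set `X` is *bad*
when it carries no local coarse period (`δ ≤ ‖t‖ ≤ b`, precision `δ/4`, two-sided).

* `cleanWindows_of_sparse` — if in some `δ`-separated `r`-dense hull point `X` the disjoint families of bad balls
  centred in the window `‖c‖ ≤ L` have cardinality `o(L³)` (any fixed separation, here `> 8b+2`), then for every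
  `L` some hull point WITH THE SAME CONSTANTS is clean on the window `‖c‖ ≤ L`: a cubic grid of `n³` candidate
  windows with spacing `D = 2L + 8 max(b,0) + 3`, one bad centre per window, gives `n³` pairwise `(8b+2)`-separated
  bad centres inside radius `2Dn + L`, contradicting sparseness for `n` large; the clean window is re-centred, and
  re-centring a hull point gives a hull point (the hull is translation invariant).
* `mesoscopicCoarsePeriods_of_badBallsSparse` — with the compactness step (`Theorems.PeriodCoherenceLadderCleanRegions`)
  the crux `MesoscopicCoarsePeriods` is REDUCED to the single Lennard-Jones statement «bad balls are sparse in
  some Delone hull point of the ground states» (energy localisation of frustration + `o(N)` excess energy).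
-/

noncomputable section

namespace Summit.AtomisticToContinuum.Crystallization.Theorems

namespace PeriodCoherenceLadderCleanWindows

open Literature.MathematicalPhysics.StatisticalMechanics
open Filter Topology Metric

/-- Distinct naturals are at distance at least one (as reals). -/
theorem one_le_abs_sub_of_ne {a c : ℕ} (h : a ≠ c) : (1 : ℝ) ≤ |(a : ℝ) - (c : ℝ)| := by
  rcases Nat.lt_or_gt_of_ne h with hlt | hlt
  · have h1 : (a : ℝ) + 1 ≤ (c : ℝ) := by exact_mod_cast hlt
    rw [abs_sub_comm]
    exact le_trans (by linarith) (le_abs_self _)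
  · have h1 : (c : ℝ) + 1 ≤ (a : ℝ) := by exact_mod_cast hlt
    exact le_trans (by linarith) (le_abs_self _)

/-- **Sparse bad balls ⇒ clean windows at every scale (same constants).** -/
theorem cleanWindows_of_sparse (x : (N : ℕ) → (Fin N → EuclideanSpace ℝ (Fin 3)))
    (h : ∃ δ r b : ℝ, 0 < δ ∧ ∃ X : Set (EuclideanSpace ℝ (Fin 3)), (∀ p ∈ X, ∀ q ∈ X, p ≠ q → δ ≤ dist p q) ∧ (∀ c : EuclideanSpace ℝ (Fin 3), ∃ p ∈ X, dist p c ≤ r) ∧ (∀ R ε : ℝ, 0 < ε → ∃ᶠ N in Filter.atTop, ∃ t : EuclideanSpace ℝ (Fin 3), (∀ p ∈ X, ‖p‖ ≤ R → ∃ i : Fin N, dist (x N i + t) p ≤ ε) ∧ (∀ i : Fin N, ‖x N i + t‖ ≤ R → ∃ p ∈ X, dist (x N i + t) p ≤ ε)) ∧ ∀ ε : ℝ, 0 < ε → ∃ L₀ : ℝ, ∀ L : ℝ, L₀ ≤ L → ∀ F : Finset (EuclideanSpace ℝ (Fin 3)), (∀ c ∈ F, ‖c‖ ≤ L) → (∀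 c ∈ F, ¬ ∃ t : EuclideanSpace ℝ (Fin 3), δ ≤ ‖t‖ ∧ ‖t‖ ≤ b ∧ ∀ p ∈ X, dist p c ≤ 4 * b + 1 → (∃ q ∈ X, dist (p + t) q ≤ δ / 4) ∧ (∃ q ∈ X, dist (p - t) q ≤ δ / 4)) → (∀ c ∈ F, ∀ c' ∈ F, c ≠ c' → 8 * b + 2 < dist c c') → (F.card : ℝ) ≤ ε * L ^ 3) :
    ∃ δ r b : ℝ, 0 < δ ∧ ∀ L : ℝ, ∃ X : Set (EuclideanSpace ℝ (Fin 3)), (∀ p ∈ X, ∀ q ∈ X, p ≠ q → δ ≤ dist p q) ∧ (∀ c : EuclideanSpace ℝ (Fin 3), ∃ p ∈ X, dist p c ≤ r) ∧ (∀ R ε : ℝ, 0 < ε → ∃ᶠ N in Filter.atTop, ∃ t : EuclideanSpace ℝ (Fin 3), (∀ p ∈ X, ‖p‖ ≤ R → ∃ i : Fin N, dist (x N i + t) p ≤ ε) ∧ (∀ i : Fin N, ‖x N i + t‖ ≤ R → ∃ p ∈ X, dist (x N i + t) p ≤ ε)) ∧ ∀ c : EuclideanSpace ℝ (Fin 3),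 ‖c‖ ≤ L → ∃ t : EuclideanSpace ℝ (Fin 3), δ ≤ ‖t‖ ∧ ‖t‖ ≤ b ∧ ∀ p ∈ X, dist p c ≤ 4 * b + 1 → (∃ q ∈ X, dist (p + t) q ≤ δ / 4) ∧ (∃ q ∈ X, dist (p - t) q ≤ δ / 4) := by
  obtain ⟨δ, r, b, hδ, X, hsep, hden, hhull, hsparse⟩ := h
  refine ⟨δ, r, b, hδ, fun L => ?_⟩
  -- Step 1: some translate of the window of radius L is free of bad centres
  have hwin : ∃ u : EuclideanSpace ℝ (Fin 3), ∀ c : EuclideanSpace ℝ (Fin 3), ‖c‖ ≤ L → ∃ t : EuclideanSpace ℝ (Fin 3), δ ≤ ‖t‖ ∧ ‖t‖ ≤ b ∧ ∀ p ∈ X, dist p (c + u) ≤ 4 * b + 1 → (∃ q ∈ X, dist (p + t) q ≤ δ / 4) ∧ (∃ q ∈ X, dist (p - t) q ≤ δ / 4) := by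
    by_cases hL : L < 0
    · exact ⟨0, fun c hc => absurd (lt_of_le_of_lt hc hL) (not_lt.2 (norm_nonneg c))⟩
    rw [not_lt] at hL
    by_contra hcon
    have habs : ∀ u : EuclideanSpace ℝ (Fin 3), ∃ c : EuclideanSpace ℝ (Fin 3), ‖c‖ ≤ L ∧ ¬ (∃ t : EuclideanSpace ℝ (Fin 3), δ ≤ ‖t‖ ∧ ‖t‖ ≤ b ∧ ∀ p ∈ X, dist p (c + u) ≤ 4 * b + 1 → (∃ q ∈ X, dist (p + t) q ≤ δ / 4) ∧ (∃ q ∈ X, dist (p - t) q ≤ δ / 4)) := by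
      intro u
      by_contra h'
      exact hcon ⟨u, fun c hc => by
        by_contra hg
        exact h' ⟨c, hc, hg⟩⟩
    choose cb hcbL hcbBad using habs
    -- the grid
    set D : ℝ := 2 * L + 8 * max b 0 + 3 with hD
    have hmax : 0 ≤ max b 0 := le_max_right _ _
    have hbmax : b ≤ max b 0 := le_max_left _ _
    have hD3 : 3 ≤ D := by linarith
    have hD0 : 0 ≤ D := by linarith
    -- sparseness at a suitable ε
    set K : ℝ := 2 * D + L + 1 with hK
    have hK1 : 1 ≤ K := by linarith
    obtain ⟨L₀, hL₀⟩ := hsparse (1 / (2 * K ^ 3)) (by positivity)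
    obtain ⟨n, hn⟩ := exists_nat_ge (max L₀ 1)
    have hn1 : (1 : ℝ) ≤ n := (le_max_right _ _).trans hn
    have hnL₀ : L₀ ≤ n := (le_max_left _ _).trans hn
    let ug : (Fin 3 → Fin n) → EuclideanSpace ℝ (Fin 3) := fun g => WithLp.toLp 2 (fun m : Fin 3 => D * ((g m : ℕ) : ℝ))
    have hug_apply : ∀ g (m : Fin 3), ug g m = D * ((g m : ℕ) : ℝ) := fun g m => rfl
    have hcoord_le : ∀ g (m : Fin 3), ‖ug g m‖ ≤ D * n := by
      intro g m
      rw [hug_apply, Real.norm_eq_abs, abs_of_nonneg (by positivity)]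
      have : ((g m : ℕ) : ℝ) ≤ n := by exact_mod_cast (g m).is_lt.le
      exact mul_le_mul_of_nonneg_left this hD0
    have hnorm : ∀ g, ‖ug g‖ ≤ 2 * D * n := by
      intro g
      rw [EuclideanSpace.norm_eq]
      have hs : ∑ m, ‖ug g m‖ ^ 2 ≤ (2 * D * n) ^ 2 := by
        calc ∑ m, ‖ug g m‖ ^ 2 ≤ ∑ _m : Fin 3, (D * n) ^ 2 :=
              Finset.sum_le_sum fun m _ => pow_le_pow_left₀ (norm_nonneg _) (hcoord_le g m) 2
          _ = 3 * (D * n) ^ 2 := by simp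
          _ ≤ (2 * D * n) ^ 2 := by nlinarith [sq_nonneg (D * n)]
      calc Real.sqrt (∑ m, ‖ug g m‖ ^ 2) ≤ Real.sqrt ((2 * D * n) ^ 2) := Real.sqrt_le_sqrt hs
        _ = 2 * D * n := Real.sqrt_sq (by positivity)
    have hsepgrid : ∀ g g', g ≠ g' → D ≤ dist (ug g) (ug g') := by
      intro g g' hgg
      obtain ⟨m, hm⟩ := Function.ne_iff.1 hgg
      have hm' : (g m : ℕ) ≠ (g' m : ℕ) := fun h => hm (Fin.ext h)
      have h1 : dist (ug g m) (ug g' m) ≤ dist (ug g) (ug g') := PiLp.dist_apply_le (ug g) (ug g') m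
      have h2 : dist (ug g m) (ug g' m) = D * |((g m : ℕ) : ℝ) - ((g' m : ℕ) : ℝ)| := by
        rw [hug_apply, hug_apply, Real.dist_eq, ← mul_sub, abs_mul, abs_of_nonneg hD0]
      have h3 := one_le_abs_sub_of_ne hm'
      calc D = D * 1 := (mul_one D).symm
        _ ≤ D * |((g m : ℕ) : ℝ) - ((g' m : ℕ) : ℝ)| := mul_le_mul_of_nonneg_left h3 hD0
        _ = dist (ug g m) (ug g' m) := h2.symm
        _ ≤ dist (ug g) (ug g') := h1
    -- the bad centres attached to the grid
    let a : (Fin 3 → Fin n) → EuclideanSpace ℝ (Fin 3) := fun g => cb (ug g) + ug g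
    have ha_norm : ∀ g, ‖a g‖ ≤ 2 * D * n + L := by
      intro g
      calc ‖cb (ug g) + ug g‖ ≤ ‖cb (ug g)‖ + ‖ug g‖ := norm_add_le _ _
        _ ≤ L + 2 * D * n := add_le_add (hcbL _) (hnorm g)
        _ = 2 * D * n + L := add_comm _ _
    have ha_sep : ∀ g g', g ≠ g' → 8 * max b 0 + 3 ≤ dist (a g) (a g') := by
      intro g g' hgg
      have h1 := hsepgrid g g' hgg
      have h2 : dist (ug g) (ug g') ≤ dist (a g) (a g') + ‖cb (ug g)‖ + ‖cb (ug g')‖ := by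
        have e1 : ug g = a g - cb (ug g) := by simp [a]
        have e2 : ug g' = a g' - cb (ug g') := by simp [a]
        calc dist (ug g) (ug g') = dist (a g - cb (ug g)) (a g' - cb (ug g')) := by rw [← e1, ← e2]
          _ ≤ dist (a g) (a g') + dist (cb (ug g)) (cb (ug g')) := dist_sub_sub_le _ _ _ _
          _ ≤ dist (a g) (a g') + (‖cb (ug g)‖ + ‖cb (ug g')‖) := by
              gcongr
              exact dist_le_norm_add_norm _ _
          _ = dist (a g) (a g') + ‖cb (ug g)‖ + ‖cb (ug g')‖ := by ring
      have h3 := hcbL (ug g)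
      have h4 := hcbL (ug g')
      rw [hD] at h1
      linarith
    have ha_inj : Function.Injective a := by
      intro g g' hgg
      by_contra hne
      have h1 := ha_sep g g' hne
      rw [hgg, dist_self] at h1
      linarith
    -- the finite family and the contradiction with sparseness
    let F : Finset (EuclideanSpace ℝ (Fin 3)) := Finset.univ.image a
    have hFcard : (F.card : ℝ) = (n : ℝ) ^ 3 := by
      have : F.card = n ^ 3 := by
        rw [Finset.card_image_of_injective _ ha_inj, Finset.card_univ, Fintype.card_fun, Fintype.card_fin,
          Fintype.card_fin]
      rw [this]
      push_cast
      ring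
    have hL' : L₀ ≤ 2 * D * n + L := by nlinarith
    have hF1 : ∀ c ∈ F, ‖c‖ ≤ 2 * D * n + L := by
      intro c hc
      obtain ⟨g, -, rfl⟩ := Finset.mem_image.1 hc
      exact ha_norm g
    have hF2 : ∀ c ∈ F, ¬ (∃ t : EuclideanSpace ℝ (Fin 3), δ ≤ ‖t‖ ∧ ‖t‖ ≤ b ∧ ∀ p ∈ X, dist p (c) ≤ 4 * b + 1 → (∃ q ∈ X, dist (p + t) q ≤ δ / 4) ∧ (∃ q ∈ X, dist (p - t) q ≤ δ / 4)) := by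
      intro c hc
      obtain ⟨g, -, rfl⟩ := Finset.mem_image.1 hc
      exact hcbBad (ug g)
    have hF3 : ∀ c ∈ F, ∀ c' ∈ F, c ≠ c' → 8 * b + 2 < dist c c' := by
      intro c hc c' hc' hcc
      obtain ⟨g, -, rfl⟩ := Finset.mem_image.1 hc
      obtain ⟨g', -, rfl⟩ := Finset.mem_image.1 hc'
      have hgg : g ≠ g' := fun h => hcc (by rw [h])
      have := ha_sep g g' hgg
      linarith
    have hbound := hL₀ (2 * D * n + L) hL' F hF1 hF2 hF3
    rw [hFcard] at hbound
    have hwin_le : 2 * D * n + L ≤ n * K := by rw [hK]; nlinarith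
    have hpow : (2 * D * n + L) ^ 3 ≤ (n * K) ^ 3 :=
      pow_le_pow_left₀ (by positivity) hwin_le 3
    have hK3 : 0 < K ^ 3 := by positivity
    have h1 : (n : ℝ) ^ 3 ≤ 1 / (2 * K ^ 3) * (n * K) ^ 3 :=
      hbound.trans (mul_le_mul_of_nonneg_left hpow (by positivity))
    have h2 : 1 / (2 * K ^ 3) * ((n : ℝ) * K) ^ 3 = (n : ℝ) ^ 3 / 2 := by
      field_simp
    rw [h2] at h1
    have h3 : (1 : ℝ) ≤ (n : ℝ) ^ 3 := one_le_pow₀ hn1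
    linarith
  -- Step 2: re-centre the hull point at the clean window
  obtain ⟨u, hu⟩ := hwin
  refine ⟨{p | p + u ∈ X}, ?_, ?_, ?_, ?_⟩
  · -- separation
    intro p hp q hq hpq
    have hp' : p + u ∈ X := hp
    have hq' : q + u ∈ X := hq
    have := hsep (p + u) hp' (q + u) hq' (fun h => hpq (add_right_cancel h))
    rwa [dist_add_right] at this
  · -- relative density
    intro c
    obtain ⟨p, hp, hpc⟩ := hden (c + u)
    refine ⟨p - u, ?_, ?_⟩
    · show p - u + u ∈ X
      rwa [sub_add_cancel]
    · have : p - u - c = p - (c + u) := by abel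
      rw [dist_eq_norm, this, ← dist_eq_norm]
      exact hpc
  · -- hull point (the hull is translation invariant)
    intro R ε hε
    refine (hhull (R + ‖u‖) ε hε).mono ?_
    rintro N ⟨t, h1, h2⟩
    refine ⟨t - u, fun p hp hpR => ?_, fun i hi => ?_⟩
    · have hp' : p + u ∈ X := hp
      have hpR' : ‖p + u‖ ≤ R + ‖u‖ := (norm_add_le _ _).trans (by linarith)
      obtain ⟨i, hi⟩ := h1 (p + u) hp' hpR'
      refine ⟨i, ?_⟩
      have : x N i + (t - u) - p = x N i + t - (p + u) := by abel
      rw [dist_eq_norm, this, ← dist_eq_norm]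
      exact hi
    · have hiR : ‖x N i + t‖ ≤ R + ‖u‖ := by
        have : x N i + t = (x N i + (t - u)) + u := by abel
        rw [this]
        exact (norm_add_le _ _).trans (by linarith)
      obtain ⟨p, hp, hd⟩ := h2 i hiR
      refine ⟨p - u, ?_, ?_⟩
      · show p - u + u ∈ X
        rwa [sub_add_cancel]
      · have : x N i + (t - u) - (p - u) = x N i + t - p := by abel
        rw [dist_eq_norm, this, ← dist_eq_norm]
        exact hd
  · -- clean on the window
    intro c hc
    obtain ⟨t, hta, htb, hgood⟩ := hu c hc
    refine ⟨t, hta, htb, fun p hp hpc => ?_⟩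
    have hp' : p + u ∈ X := hp
    have hpc' : dist (p + u) (c + u) ≤ 4 * b + 1 := by rwa [dist_add_right]
    obtain ⟨⟨q₁, hq₁, hd₁⟩, ⟨q₂, hq₂, hd₂⟩⟩ := hgood (p + u) hp' hpc'
    refine ⟨⟨q₁ - u, ?_, ?_⟩, ⟨q₂ - u, ?_, ?_⟩⟩
    · show q₁ - u + u ∈ X
      rwa [sub_add_cancel]
    · have : p + t - (q₁ - u) = p + u + t - q₁ := by abel
      rw [dist_eq_norm, this, ← dist_eq_norm]
      exact hd₁
    · show q₂ - u + u ∈ X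
      rwa [sub_add_cancel]
    · have : p - t - (q₂ - u) = p + u - t - q₂ := by abel
      rw [dist_eq_norm, this, ← dist_eq_norm]
      exact hd₂

/-- **The residual crux reduced to sparseness of bad balls.**  `MesoscopicCoarsePeriods` follows from the single
Lennard-Jones statement: in some Delone hull point of the ground states the disjoint `(8b+2)`-separated families
of bad balls centred in the window of radius `L` have cardinality `o(L³)`. -/
theorem mesoscopicCoarsePeriods_of_badBallsSparse
    (hsparse : ∀ x : (N : ℕ) → (Fin N → EuclideanSpace ℝ (Fin 3)), (∀ N, Literature.MathematicalPhysics.StatisticalMechanics.IsGroundState Literature.MathematicalPhysics.StatisticalMechanics.lennardJones (x N)) → (∃ X : Set (EuclideanSpace ℝ (Fin 3)), ((∃ δ : ℝ, 0 < δ ∧ ∀ p ∈ X, ∀ q ∈ X, p ≠ q → δ ≤ dist p q) ∧ (∃ r : ℝ, ∀ c : EuclideanSpace ℝ (Fin 3), ∃ p ∈ X, dist p c ≤ r)) ∧ (∀ R ε : ℝ, 0 < ε → ∃ᶠ N in Filter.atTop, ∃ t : EuclideanSpace ℝ (Fin 3), (∀ p ∈ X, ‖p‖ ≤ R → ∃ i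 : Fin N, dist (x N i + t) p ≤ ε) ∧ (∀ i : Fin N, ‖x N i + t‖ ≤ R → ∃ p ∈ X, dist (x N i + t) p ≤ ε))) → ∃ δ r b : ℝ, 0 < δ ∧ ∃ X : Set (EuclideanSpace ℝ (Fin 3)), (∀ p ∈ X, ∀ q ∈ X, p ≠ q → δ ≤ dist p q) ∧ (∀ c : EuclideanSpace ℝ (Fin 3), ∃ p ∈ X, dist p c ≤ r) ∧ (∀ R ε : ℝ, 0 < ε → ∃ᶠ N in Filter.atTop, ∃ t : EuclideanSpace ℝ (Fin 3), (∀ p ∈ X, ‖p‖ ≤ R → ∃ i : Fin N, dist (x N i + t) p ≤ ε) ∧ (∀ i : Fin N, ‖x N i + t‖ ≤ R → ∃ p ∈ X, dist (x N i + t) p ≤ ε)) ∧ ∀ ε : ℝ, 0 < ε → ∃ L₀ : ℝ, ∀ L : ℝ, L₀ ≤ L → ∀ F : Finset (EuclideanSpace ℝ (Fin 3)), (∀ c ∈ F, ‖c‖ ≤ L) → (∀ c ∈ F, ¬ ∃ t : EuclideanSpace ℝ (Fin 3), δ ≤ ‖t‖ ∧ ‖t‖ ≤ b ∧ ∀ p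 ∈ X, dist p c ≤ 4 * b + 1 → (∃ q ∈ X, dist (p + t) q ≤ δ / 4) ∧ (∃ q ∈ X, dist (p - t) q ≤ δ / 4)) → (∀ c ∈ F, ∀ c' ∈ F, c ≠ c' → 8 * b + 2 < dist c c') → (F.card : ℝ) ≤ ε * L ^ 3) :
    Summit.AtomisticToContinuum.Crystallization.Theses.PeriodCoherenceLadder.MesoscopicCoarsePeriods :=
  PeriodCoherenceLadderCleanRegions.mesoscopicCoarsePeriods_of_cleanRegions
    (fun x hx h0 => cleanWindows_of_sparse x (hsparse x hx h0))

end PeriodCoherenceLadderCleanWindows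

end Summit.AtomisticToContinuum.Crystallization.Theorems

end
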